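import Summits.Ventures.PercRepro.ProfileFlatUpsetThreshold

/-!
# PercRepro — (G) AT EVERY PRINCIPAL UP-SET GENERATED BY A HYPERPLANE (a kernel theorem with negative terms)
(p10, gen 18; `proofs/P10-AVFULL.md` §26(a))

For a finite matroid `M` of rank `r` and a hyperplane `H` (a flat of rank `r − 1`, `IsHyperplaneF`), the flats
containing `H` form the principal up-set `principalUp M H` (`upFlats_principalUp`) — the modular cut of a point placed
freely on `H`.  THEOREM (`sum_sepSets_principal_hyperplane_nonneg`): the signed sum of the conjecture (G)
(`FlatUpsetLimit`, NOT asserted in general) is non-negative there.  A separated `Z` has `#Z ≥ r − 1` (its closure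
contains `H`) and `#(E ∖ Z) ≤ r − 1` (its complement does not span), so every term `#Z − #(E ∖ Z) − 1` is `≥ 0`
except when `#Z = #(E ∖ Z) = r − 1` — then `Z` is a basis of `H` (`subset_of_mem_sepSets_card`) and the term is `−1`;
these are injected (`hypMap`: add an element of `E ∖ Z` outside `H`, the image determines `Z = (Z ∪ x) ∩ H`) into the
terms `+1` (`#Z = r`, `#(E ∖ Z) = r − 2`).  The first principal case of (G) that is not termwise; the threshold case
(ProfileFlatUpsetThreshold) and this one are the kernel instances of (G) beyond the modular cuts of gens 15–17.
-/

open scoped Matroid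

namespace PercRepro.Cogirth

open Finset ThmH Skew

variable {α : Type} [DecidableEq α] {M : Matroid α} [M.Finite]

/-! ### Principal up-sets and hyperplanes -/

open scoped Classical in
/-- The principal up-set generated by `F₀`: the flats containing `F₀`. -/
noncomputable def principalUp (M : Matroid α) [M.Finite] (F₀ : Finset α) : Finset (Finset α) :=
  (gr M).powerset.filter (fun F => IsFlatF M F ∧ F₀ ⊆ F)

open scoped Classical in
/-- Membership in `principalUp`. -/
theorem mem_principalUp {F₀ F : Finset α} :
    F ∈ principalUp M F₀ ↔ F ⊆ gr M ∧ IsFlatF M F ∧ F₀ ⊆ F := by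
  unfold principalUp
  rw [mem_filter, mem_powerset]

/-- The principal family is an up-set of flats. -/
theorem upFlats_principalUp (F₀ : Finset α) : UpFlats M (principalUp M F₀) where
  flat := fun F hF => (mem_principalUp.1 hF).2.1
  up := by
    intro F hF G hG hFG
    rw [mem_principalUp] at hF ⊢
    exact ⟨hG.1, hG, hF.2.2.trans hFG⟩

/-- A hyperplane: a flat of rank one less than the rank of `M`. -/
def IsHyperplaneF (M : Matroid α) [M.Finite] (H : Finset α) : Prop :=
  IsFlatF M H ∧ rk M H + 1 = rk M (gr M)

/-! ### Rank facts -/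

/-- A subset of the ground set of full rank spans the ground set. -/
theorem clF_eq_gr_of_rk_eq {X : Finset α} (hX : X ⊆ gr M) (hr : rk M X = rk M (gr M)) : clF M X = gr M := by
  apply Subset.antisymm (clF_subset_gr_fu X)
  intro x hx
  rw [mem_clF_iff_rk_insert_eq hx hX]
  apply le_antisymm
  · have h1 : rk M (insert x X) ≤ rk M (gr M) := rk_mono_fu (insert_subset hx hX)
    rw [hr]
    exact h1
  · exact rk_mono_fu (subset_insert x X)

/-- A set whose closure contains a flat of the same rank lies in that flat. -/
theorem subset_of_subset_clF_of_rk_eq {X F : Finset α} (hF : IsFlatF M F)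
    (hFX : F ⊆ clF M X) (hr : rk M F = rk M X) : clF M X ⊆ F := by
  intro y hy
  have hyg : y ∈ gr M := clF_subset_gr_fu X hy
  have h1 : insert y F ⊆ clF M X := insert_subset hy hFX
  have h2 : rk M (insert y F) ≤ rk M X := by
    have := rk_mono_fu (M := M) h1
    rwa [rk_clF_eq_fu] at this
  have h3 : rk M (insert y F) = rk M F := by
    apply le_antisymm
    · rw [hr]; exact h2
    · exact rk_mono_fu (subset_insert y F)
  have h4 : y ∈ clF M F := (mem_clF_iff_rk_insert_eq hyg hF.1).2 h3
  rw [hF.2] at h4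
  exact h4

/-! ### The separated sets of a hyperplane's principal up-set -/

/-- The two size bounds for a set separated by `principalUp M H`: `#Z ≥ r − 1` and `#(E ∖ Z) ≤ r − 1`. -/
theorem card_bounds_of_mem_sepSets_hyperplane {H : Finset α} (hH : IsHyperplaneF M H) {Z : Finset α}
    (hZ : Z ∈ sepSets M (principalUp M H)) :
    rk M H ≤ Z.card ∧ (gr M \ Z).card + 1 ≤ rk M (gr M) := by
  rw [mem_sepSets, mem_biIndepAll] at hZ
  obtain ⟨⟨hZg, hZr, hZc⟩, hin, hout⟩ := hZ
  rw [mem_principalUp] at hin hout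
  obtain ⟨_, _, hHZ⟩ := hin
  refine ⟨?_, ?_⟩
  · have := rk_mono_fu (M := M) hHZ
    rwa [rk_clF_eq_fu, hZr] at this
  · by_contra hcon
    have hle : rk M (gr M \ Z) ≤ rk M (gr M) := rk_mono_fu sdiff_subset
    have heq : rk M (gr M \ Z) = rk M (gr M) := by omega
    apply hout
    refine ⟨clF_subset_gr_fu _, isFlatF_clF _, ?_⟩
    rw [clF_eq_gr_of_rk_eq sdiff_subset heq]
    exact hH.1.1

/-- A separated set with `#Z = r − 1` is a basis of `H`: it lies in `H`. -/
theorem subset_of_mem_sepSets_card {H : Finset α} (hH : IsHyperplaneF M H) {Z : Finset α}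
    (hZ : Z ∈ sepSets M (principalUp M H)) (hcard : Z.card = rk M H) : Z ⊆ H := by
  have hZ' := hZ
  rw [mem_sepSets, mem_biIndepAll] at hZ'
  obtain ⟨⟨hZg, hZr, _⟩, hin, _⟩ := hZ'
  rw [mem_principalUp] at hin
  have h1 : clF M Z ⊆ H := subset_of_subset_clF_of_rk_eq hH.1 hin.2.2 (by rw [hZr, hcard])
  exact (subset_clF_fu hZg).trans h1

/-- The negative terms: `#Z = r − 1` and `#(E ∖ Z) = r − 1`. -/
noncomputable def negSet (M : Matroid α) [M.Finite] (H : Finset α) : Finset (Finset α) :=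
  (sepSets M (principalUp M H)).filter (fun Z => Z.card + 1 = rk M (gr M) ∧ (gr M \ Z).card + 1 = rk M (gr M))

/-- The terms `+1`: `#Z = r` and `#(E ∖ Z) = r − 2`. -/
noncomputable def posSet (M : Matroid α) [M.Finite] (H : Finset α) : Finset (Finset α) :=
  (sepSets M (principalUp M H)).filter (fun Z => Z.card = rk M (gr M) ∧ (gr M \ Z).card + 2 = rk M (gr M))

/-- The injection: add to `Z` an element of `E ∖ Z` outside `H` (any one). -/
noncomputable def hypMap (M : Matroid α) [M.Finite] (H Z : Finset α) : Finset α :=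
  if h : ((gr M \ Z) \ H).Nonempty then insert h.choose Z else Z

/-- For a negative term, an element of `E ∖ Z` outside `H` exists. -/
theorem exists_notMem_of_mem_negSet {H : Finset α} (hH : IsHyperplaneF M H) {Z : Finset α}
    (hZ : Z ∈ negSet M H) : ((gr M \ Z) \ H).Nonempty := by
  unfold negSet at hZ
  rw [mem_filter] at hZ
  obtain ⟨hZs, hc1, _⟩ := hZ
  have hZH : Z ⊆ H := subset_of_mem_sepSets_card hH hZs (by have := hH.2; omega)
  have hZg : Z ⊆ gr M := (mem_biIndepAll.1 (mem_sepSets.1 hZs).1).1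
  by_contra hcon
  rw [not_nonempty_iff_eq_empty, sdiff_eq_empty_iff_subset] at hcon
  have hgH : gr M ⊆ H := by
    intro x hx
    by_cases hxZ : x ∈ Z
    · exact hZH hxZ
    · exact hcon (mem_sdiff.2 ⟨hx, hxZ⟩)
  have := rk_mono_fu (M := M) hgH
  have := hH.2
  omega

/-- The injection maps the negative terms into the positive ones. -/
theorem hypMap_mem_posSet {H : Finset α} (hH : IsHyperplaneF M H) {Z : Finset α} (hZ : Z ∈ negSet M H) :
    hypMap M H Z ∈ posSet M H := by
  have hne := exists_notMem_of_mem_negSet hH hZ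
  have hx := hne.choose_spec
  set x := hne.choose with hxdef
  unfold hypMap
  rw [dif_pos hne, ← hxdef]
  unfold negSet at hZ
  rw [mem_filter] at hZ
  obtain ⟨hZs, hc1, hc2⟩ := hZ
  have hZs' := hZs
  rw [mem_sepSets, mem_biIndepAll] at hZs'
  obtain ⟨⟨hZg, hZr, hZc⟩, hin, hout⟩ := hZs'
  rw [mem_sdiff, mem_sdiff] at hx
  obtain ⟨⟨hxg, hxZ⟩, hxH⟩ := hx
  have hZH : Z ⊆ H := subset_of_mem_sepSets_card hH hZs (by have := hH.2; omega)
  have hclZ : clF M Z ⊆ H := by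
    rw [mem_principalUp] at hin
    exact subset_of_subset_clF_of_rk_eq hH.1 hin.2.2 (by have := hH.2; omega)
  have hxcl : x ∉ clF M Z := fun h => hxH (hclZ h)
  rw [mem_clF_iff_rk_insert_eq hxg hZg] at hxcl
  have hrk1 : rk M (insert x Z) = Z.card + 1 := by
    have h1 := rk_insert_le (M := M) x Z
    have h2 := rk_mono_fu (M := M) (subset_insert x Z)
    omega
  have hcomp : gr M \ insert x Z = (gr M \ Z).erase x := by
    ext y
    simp only [mem_sdiff, mem_insert, mem_erase, not_or]
    tauto
  have hcind : M.Indep ((gr M \ Z : Finset α) : Set α) := indep_of_rk_eq_card' hZc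
  have hrk2 : rk M (gr M \ insert x Z) = (gr M \ insert x Z).card := by
    rw [hcomp]
    apply rk_eq_card_of_indep
    exact hcind.subset (by rw [coe_erase]; exact Set.sdiff_subset)
  have hcard2 : (gr M \ insert x Z).card + 1 = (gr M \ Z).card := by
    rw [hcomp, card_erase_add_one (mem_sdiff.2 ⟨hxg, hxZ⟩)]
  unfold posSet
  rw [mem_filter, mem_sepSets, mem_biIndepAll]
  refine ⟨⟨⟨insert_subset hxg hZg, by rw [hrk1, card_insert_of_notMem hxZ], hrk2⟩, ?_, ?_⟩,
    by rw [card_insert_of_notMem hxZ]; omega, by omega⟩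
  · rw [mem_principalUp] at hin ⊢
    exact ⟨clF_subset_gr_fu _, isFlatF_clF _, hin.2.2.trans (clF_mono_fu (subset_insert x Z))⟩
  · intro hcon
    rw [mem_principalUp] at hcon
    have h1 := rk_mono_fu (M := M) hcon.2.2
    rw [rk_clF_eq_fu, hrk2] at h1
    have := hH.2
    omega

/-- The injection is injective on the negative terms: `Z = (Z ∪ x) ∩ H`. -/
theorem hypMap_injOn {H : Finset α} (hH : IsHyperplaneF M H) : Set.InjOn (hypMap M H) (negSet M H) := by
  intro Z₁ hZ₁ Z₂ hZ₂ heq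
  have hZ₁' : Z₁ ∈ negSet M H := hZ₁
  have hZ₂' : Z₂ ∈ negSet M H := hZ₂
  have key : ∀ Z ∈ negSet M H, (hypMap M H Z) ∩ H = Z := by
    intro Z hZ
    have hne := exists_notMem_of_mem_negSet hH hZ
    have hx := hne.choose_spec
    have hZs : Z ∈ sepSets M (principalUp M H) := (mem_filter.1 hZ).1
    have hZH : Z ⊆ H := subset_of_mem_sepSets_card hH hZs (by have := hH.2; have := (mem_filter.1 hZ).2.1; omega)
    unfold hypMap
    rw [dif_pos hne]
    rw [mem_sdiff, mem_sdiff] at hx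
    ext y
    simp only [mem_inter, mem_insert]
    constructor
    · rintro ⟨(rfl | hy), hyH⟩
      · exact absurd hyH hx.2
      · exact hy
    · intro hy
      exact ⟨Or.inr hy, hZH hy⟩
  rw [← key Z₁ hZ₁', ← key Z₂ hZ₂', heq]

/-- The negative terms are at most the positive ones. -/
theorem card_negSet_le_card_posSet {H : Finset α} (hH : IsHyperplaneF M H) :
    (negSet M H).card ≤ (posSet M H).card :=
  card_le_card_of_injOn (hypMap M H) (fun _ hZ => hypMap_mem_posSet hH hZ) (hypMap_injOn hH)

/-- Every term is at least `[Z ∈ posSet] − [Z ∈ negSet]`. -/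
theorem term_ge_of_mem_sepSets_hyperplane {H : Finset α} (hH : IsHyperplaneF M H) {Z : Finset α}
    (hZ : Z ∈ sepSets M (principalUp M H)) :
    ((if Z ∈ posSet M H then 1 else 0 : ℤ) - (if Z ∈ negSet M H then 1 else 0)) ≤
      2 * (Z.card : ℤ) - (gr M).card - 1 := by
  obtain ⟨hb1, hb2⟩ := card_bounds_of_mem_sepSets_hyperplane hH hZ
  have hZg : Z ⊆ gr M := (mem_biIndepAll.1 (mem_sepSets.1 hZ).1).1
  have hN : (gr M).card = Z.card + (gr M \ Z).card := by
    have := card_le_card hZg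
    rw [card_sdiff_of_subset hZg]
    omega
  have hr := hH.2
  have hcZ : Z.card ≤ rk M (gr M) := by
    have := rk_mono_fu (M := M) hZg
    rw [(mem_biIndepAll.1 (mem_sepSets.1 hZ).1).2.1] at this
    exact this
  have hmem : Z ∈ posSet M H ↔ Z.card = rk M (gr M) ∧ (gr M \ Z).card + 2 = rk M (gr M) := by
    unfold posSet; rw [mem_filter]; exact ⟨fun h => h.2, fun h => ⟨hZ, h⟩⟩
  have hmem' : Z ∈ negSet M H ↔ Z.card + 1 = rk M (gr M) ∧ (gr M \ Z).card + 1 = rk M (gr M) := by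
    unfold negSet; rw [mem_filter]; exact ⟨fun h => h.2, fun h => ⟨hZ, h⟩⟩
  have hN' : ((gr M).card : ℤ) = Z.card + (gr M \ Z).card := by exact_mod_cast hN
  by_cases hp : Z ∈ posSet M H
  · rw [if_pos hp]
    have hp' := hmem.1 hp
    have hn : Z ∉ negSet M H := fun h => by have := (hmem'.1 h).1; omega
    rw [if_neg hn]
    have h1 : (Z.card : ℤ) = rk M (gr M) := by exact_mod_cast hp'.1
    have h2 : ((gr M \ Z).card : ℤ) + 2 = rk M (gr M) := by exact_mod_cast hp'.2
    linarith
  · rw [if_neg hp]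
    by_cases hn : Z ∈ negSet M H
    · rw [if_pos hn]
      have hn' := hmem'.1 hn
      have h1 : (Z.card : ℤ) + 1 = rk M (gr M) := by exact_mod_cast hn'.1
      have h2 : ((gr M \ Z).card : ℤ) + 1 = rk M (gr M) := by exact_mod_cast hn'.2
      linarith
    · rw [if_neg hn]
      -- neither: either #Z ≥ r, or #Z = r − 1 and #(E ∖ Z) ≤ r − 2
      have h1 : (rk M H : ℤ) ≤ Z.card := by exact_mod_cast hb1
      have h2 : ((gr M \ Z).card : ℤ) + 1 ≤ rk M (gr M) := by exact_mod_cast hb2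
      have h3 : (rk M H : ℤ) + 1 = rk M (gr M) := by exact_mod_cast hr
      have h4 : (Z.card : ℤ) ≤ rk M (gr M) := by exact_mod_cast hcZ
      by_cases hZr : Z.card = rk M (gr M)
      · -- #Z = r: if #(E∖Z) = r − 2 it would be in posSet; so #(E ∖ Z) ≤ r − 3 or = r − 1
        have h5 : (Z.card : ℤ) = rk M (gr M) := by exact_mod_cast hZr
        have h6 : (gr M \ Z).card + 2 ≠ rk M (gr M) := fun h => hp (hmem.2 ⟨hZr, h⟩)
        have h7 : ((gr M \ Z).card : ℤ) + 2 ≠ rk M (gr M) := by exact_mod_cast h6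
        omega
      · have h5 : Z.card + 1 = rk M (gr M) := by omega
        have h6 : (gr M \ Z).card + 1 ≠ rk M (gr M) := fun h => hn (hmem'.2 ⟨h5, h⟩)
        have h7 : ((gr M \ Z).card : ℤ) + 1 ≠ rk M (gr M) := by exact_mod_cast h6
        have h8 : (Z.card : ℤ) + 1 = rk M (gr M) := by exact_mod_cast h5
        omega

/-- **(G) AT THE PRINCIPAL UP-SET OF A HYPERPLANE**: the signed sum is non-negative. -/
theorem sum_sepSets_principal_hyperplane_nonneg {H : Finset α} (hH : IsHyperplaneF M H) :
    0 ≤ ∑ Z ∈ sepSets M (principalUp M H), (2 * (Z.card : ℤ) - (gr M).card - 1) := by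
  have h1 : ∑ Z ∈ sepSets M (principalUp M H),
      ((if Z ∈ posSet M H then 1 else 0 : ℤ) - (if Z ∈ negSet M H then 1 else 0)) ≤
        ∑ Z ∈ sepSets M (principalUp M H), (2 * (Z.card : ℤ) - (gr M).card - 1) :=
    sum_le_sum (fun Z hZ => term_ge_of_mem_sepSets_hyperplane hH hZ)
  have hP : (sepSets M (principalUp M H)).filter (fun Z => Z ∈ posSet M H) = posSet M H := by
    ext Z
    rw [mem_filter]
    exact ⟨fun h => h.2, fun h => ⟨(mem_filter.1 h).1, h⟩⟩
  have hN : (sepSets M (principalUp M H)).filter (fun Z => Z ∈ negSet M H) = negSet M H := by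
    ext Z
    rw [mem_filter]
    exact ⟨fun h => h.2, fun h => ⟨(mem_filter.1 h).1, h⟩⟩
  rw [sum_sub_distrib, sum_boole, sum_boole, hP, hN] at h1
  have h2 := card_negSet_le_card_posSet hH
  have h3 : ((negSet M H).card : ℤ) ≤ (posSet M H).card := by exact_mod_cast h2
  linarith

end PercRepro.Cogirth
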